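import Summits.BirchSwinnertonDyer.BirchSwinnertonDyer.Theorems.AlignedTransportAtTwoMainConjectureOfRankZeroBSDAtTwoCubicLayerOneUnitDoor
import Summits.BirchSwinnertonDyer.BirchSwinnertonDyer.Theorems.AlignedTransportAtTwoMainConjectureOfRankZeroBSDAtTwoCubicDoorsDeadSubcellClassNumberE
import Summits.BirchSwinnertonDyer.Rank1Residual.X5.TwoAdicInstancesToolkitB
import Literature.NumberTheory.CubicFields.CubicFieldDiscriminant13547ClassNumber
import Literature.NumberTheory.NumberFields.CubicFieldIntegers
import Literature.NumberTheory.NumberFields.CubicFieldResiduePrimes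
import Literature.NumberTheory.NumberFields.QuadraticSqrtTwoNormTwoPrimeCertificate
import HarnessLib

/-!
# Route `AlignedTransportAtTwo`, crux C2 `MainConjectureOfRankZeroBSDAtTwo` (stmt-BirchSwinnertonDyer-22298):
# THE LAYER-ONE UNIT DOOR FIRES — `e_m = e_1` for all `m ≥ 1`, `μ₂ = 0` AND `λ₂ = 0` (FINITE `X`) for the cubic `2`-torsion field of `⟨1, 0, 1, -121, 499⟩` (`N = 13547`), UNCONDITIONALLY; the kernel row `MC₂(W)` modulo PRINT⁵ + MuIneqʳ

HONEST FRAMING (cell `bsd-f1-sign2`, WIDTH-5 attached prover seat `bsd-line-att-p4` gen 39 on line `birth` of the lead `bsd-line-att-p2`;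
`--supports` stmt-BirchSwinnertonDyer-22298, closes nothing; BSD is NOT proved by any of this; the crux C2, its verdict «blocked-on
`Rank1Residual.GreenbergMuConjectureIrreducible`» and every registered stub (P/T/Kμ/LimDoor/MuIneqʳ/PFμ⁺ of `Lines/birth.lean` v9) are untouched).
THEOREMS ONLY (no `def`, no named fact beyond the displayed PRINT⁵ + MuIneqʳ of the cell, no instance, no `sorry`); the curve is written LITERALLY.

WHAT.  att-p3 g41's LAYER-ONE UNIT DOOR `…CubicLayerOneUnitDoor.classicalMuVanishes_adjoin_of_layerOneUnitCert` /
`mazurMainConjecture_two_of_muIneqRel_of_layerOneUnitCert_principal` (p798909) had NO customer: it fires iff the unit class is `±7 (mod 16)` AND the cubic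
field is in genus regime (α) (`±ε ∈ N_{K₁/K} E_{K₁}`, `K₁ = K(√2)`), and all six class-`±7` seeds with a typed class number are in regime (β) (this seat's
census `Cruxes/…/DEPTH-DOOR-CUSTOMERS-att-p4-g39.md`).  The census of the UNTYPED rank-`0` u7 seeds found the customer: `W = ⟨1, 0, 1, -121, 499⟩` (`Δ_min = −13547 =
−19·23·31 ≡ 5 (mod 8)`, rank `0`, `L/Ω = 1`; LMFDB 3.1.13547.1), whose cubic `2`-torsion field `ℚ(β)` (monogenic: `θ = 3g² + (79/4)g − 947/4 = (−947·4 + 79u + 3u²)/16`, `u = 4β`,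
`f(θ) = 0`, `f = X³ − 8X² + 20X + 7`, `d = −13547`, `h = 1` — this seat's `Literature/…/CubicFieldDiscriminant13547{,Primes,ClassNumber}`) has unit class `±7 (mod 16)` AND
regime (α).  Every displayed datum of the door is decided by the kernel in `𝓞_{ℚ(β)} = ℤ[θ]`: `h(ℚ(β)) = 1`; `𝔭₁ = (π₁)`, `π₁ = 68 -25θ +3θ²`, `N(𝔭₁) = 2`
(residue map `θ ↦ 1` mod `2`), `2 ∉ 𝔭₁²` (`2 ∤ d`); the unit `η = A + B√2` of `ℚ(β,√2)`, `A = 14 +43θ +0θ²`, `B = 11 +37θ +0θ²`, inverse `C + D√2`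
(`C = -285779578 +105190606θ -12658231θ²`, `D = -202076678 +74380991θ -8950721θ²`): `AC + 2BD = 1`, `AD + BC = 0`, `A − 1 = π₁²γ₀`, `B = π₁²γ₁`, `γ₀ − 1 = π₁·y` (`γ₀ = -268 -918θ -173θ²`,
`γ₁ = -230 -788θ -149θ²`) — so `η ≡ 1 (mod P⁴)`, `η ≢ 1 (mod P⁵)`, `η` is not a norm from `ℚ(β,√(2+√2))` (O'Meara 63:10); indeed `N_{K₁/K} η = -46 -424θ -889θ² = −ε⁻¹`,
`σ₁ ≡ 9 (mod 16)`.  THEN (★★★ `classNumberPExp_eq_and_mu_lambda_eq_zero_cubicField_n13547`, UNCONDITIONAL): for EVERY cyclotomic `ℤ₂`-extension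
`κ` of `ℚ(β)`: `e_m = e_1` for all `m ≥ 1`, `μ₂(κ) = 0`, `λ₂(κ) = 0` — the Iwasawa module is FINITE; and (★ `mazurMainConjecture_two_n13547`) `MC₂(W)` modulo
PRINT⁵ {Kato 17.4 (1)(2) at `2`, Greenberg 4.1, period unit, modularity, GZK} + MuIneqʳ (registered stub VERBATIM) + the crux's own hypotheses (`r_an = 0`,
analytic `μ₂ = 0`, `BSD₂(W)`).  THE FIRST INSTANCE OF THE LAYER-ONE DOOR; a non-Galois cubic (closure `S₃`) on the «doors-dead» u7 sub-cell.
CONDITIONAL only in the `MC₂` row; BSD is NOT proved; nothing is closed.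

References: [Fukuda1994] Thm. 1 (1); [Lang1990] Ch. 13 §4; [Omeara1963] §63B (63:10); [Washington1997] §13; [Kato2004Asterisque] Thm. 17.4; [GreenbergLNM1716]
Thm. 4.1; [SilvermanAEC2009] III.1, VII.1, VII.5; [Serre1973] II §3.3; [LMFDB] ec 13547, nf 3.1.13547.1; tree: att-p3 g41 `…CubicLayerOneUnitDoor`,
`Literature/NumberTheory/NumberFields/QuadraticSqrtTwoNormTwoPrimeCertificate`, att-p4 g38 `…CubicDoorsDeadSubcellClassNumberE` (template), `MonicCubic.*`.
-/

set_option linter.dupNamespace false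
set_option autoImplicit false

noncomputable section

open scoped Classical NumberField nonZeroDivisors IntermediateField

namespace Summit.BirchSwinnertonDyer.BirchSwinnertonDyer.Theorems.AlignedTransportAtTwoCubicLayerOneRowN13547

open NumberField IsDedekindDomain Polynomial WeierstrassCurve IntermediateField CongruenceSubgroup Module
  Literature.NumberTheory.IwasawaTheory Literature.NumberTheory.GaloisRepresentations
  Literature.NumberTheory.EllipticCurves Literature.NumberTheory.EllipticCurves.Greenberg1999
  Literature.NumberTheory.EllipticCurves.ModularForms Literature.NumberTheory.EllipticCurves.Rank1Residual
  Literature.NumberTheory.EllipticCurves.Module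
  Literature.NumberTheory.NumberFields Literature.NumberTheory.CubicFields
  Summit.BirchSwinnertonDyer.Rank1Residual Summit.BirchSwinnertonDyer.Rank1Residual.X1.MuLambda
  Summit.BirchSwinnertonDyer.Rank1Residual.X5 Summit.BirchSwinnertonDyer.Rank1Residual.X5.O1
  Summit.BirchSwinnertonDyer.Rank1Residual.X5.Instances Summit.BirchSwinnertonDyer.Rank1Residual.F1Sign2
  Summit.BirchSwinnertonDyer.BirchSwinnertonDyer.Theorems.Rank1ResidualX1Defs
  Summit.BirchSwinnertonDyer.BirchSwinnertonDyer.Theses.AlignedTransportAtTwo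
  Summit.BirchSwinnertonDyer.BirchSwinnertonDyer.Theorems.AlignedTransportAtTwoKilfordStratumShared
  Summit.BirchSwinnertonDyer.BirchSwinnertonDyer.Theorems.AlignedTransportAtTwoCubicCarrierRoad
  Summit.BirchSwinnertonDyer.BirchSwinnertonDyer.Theorems.AlignedTransportAtTwoCubicLayerOneUnitDoor
open Summit.BirchSwinnertonDyer.BirchSwinnertonDyer.Theorems.AlignedTransportAtTwoCubicKilfordPrimes (psi_gen_eq_zero)

/-! ## §0 The curve `⟨1, 0, 1, -121, 499⟩` of conductor `13547 = 19·23·31` (rank 0, `L/Ω = 1`) — kernel-decided invariants and its cubic field -/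

/-- `Δ = −13547`. [cite: SilvermanAEC2009, III.1] -/
theorem M13547_Δ : (⟨1, 0, 1, -121, 499⟩ : WeierstrassCurve ℤ).Δ = -13547 := by decide

/-- `c₄ = 5785`. [cite: SilvermanAEC2009, III.1] -/
theorem M13547_c₄ : (⟨1, 0, 1, -121, 499⟩ : WeierstrassCurve ℤ).c₄ = 5785 := by decide

/-- `⟨1, 0, 1, -121, 499⟩` is an elliptic curve (`Δ = −13547 ≠ 0`). [cite: SilvermanAEC2009, III.1] -/
theorem isElliptic_n13547 : ((⟨1, 0, 1, -121, 499⟩ : WeierstrassCurve ℤ).baseChange ℚ).IsElliptic := by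
  rw [WeierstrassCurve.isElliptic_iff, baseChange_int_Δ, M13547_Δ]; norm_num

/-- The model `⟨1, 0, 1, -121, 499⟩` is globally minimal (`gcd(Δ, c₄) = 1`). [cite: SilvermanAEC2009, VII.1 Remark 1.1] -/
theorem isGloballyMinimal_n13547 : ((⟨1, 0, 1, -121, 499⟩ : WeierstrassCurve ℤ).baseChange ℚ).IsGloballyMinimal :=
  isGloballyMinimal_baseChange_int_of_gcd_eq_one 1 (0) 1 (-121) (499) (by decide)

/-- `⟨1, 0, 1, -121, 499⟩ mod 2` is `[1, 0, 1, 1, 1]`. [folklore] -/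
theorem M13547_mod_two : (⟨1, 0, 1, -121, 499⟩ : WeierstrassCurve ℤ).map (Int.castRingHom (ZMod 2)) = ⟨1, 0, 1, 1, 1⟩ := by
  ext <;> decide

/-- `#Ẽ(𝔽₂) = 2` for `⟨1, 0, 1, -121, 499⟩` (`a₂ = 3 − 2 = 1`, odd). [cite: SilvermanAEC2009, V.2] -/
theorem M13547_card_two :
    Nat.card ((⟨1, 0, 1, -121, 499⟩ : WeierstrassCurve ℤ).map (Int.castRingHom (ZMod 2))).toAffine.Point = 2 := by
  rw [M13547_mod_two, natCard_point_eq_one_add_card _ (by decide)]; decide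

/-- **`⟨1, 0, 1, -121, 499⟩` has good ORDINARY reduction at `2`** (`2 ∤ Δ`, `#Ẽ(𝔽₂) = 2`, `a₂` odd). [cite: SilvermanAEC2009, VII.5 Prop. 5.1 (a)] -/
theorem goodOrd_two_n13547 [((⟨1, 0, 1, -121, 499⟩ : WeierstrassCurve ℤ).baseChange ℚ).IsElliptic] [((⟨1, 0, 1, -121, 499⟩ : WeierstrassCurve ℤ).baseChange ℚ).IsGloballyMinimal] : GoodOrd ((⟨1, 0, 1, -121, 499⟩ : WeierstrassCurve ℤ).baseChange ℚ) 2 :=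
  Instances.goodOrd_two_baseChange_int_of_card_two _ (by rw [M13547_Δ]; decide) M13547_card_two

/-- The coefficients of `⟨1, 0, 1, -121, 499⟩ / ℚ` (unfolded). [cite: SilvermanAEC2009, III.1] -/
theorem c13547_eq : ((⟨1, 0, 1, -121, 499⟩ : WeierstrassCurve ℤ).baseChange ℚ) = ⟨1, 0, 1, -121, 499⟩ := by
  rw [baseChange_int_eq]; norm_num

/-- `b₂, b₄, b₆` of `⟨1, 0, 1, -121, 499⟩`: `1, -241, 1997`. [cite: SilvermanAEC2009, III.1] -/
theorem c13547_b : ((⟨1, 0, 1, -121, 499⟩ : WeierstrassCurve ℤ).baseChange ℚ).b₂ = ((1 : ℤ) : ℚ) ∧ ((⟨1, 0, 1, -121, 499⟩ : WeierstrassCurve ℤ).baseChange ℚ).b₄ = ((-241 : ℤ) : ℚ) ∧ ((⟨1, 0, 1, -121, 499⟩ : WeierstrassCurve ℤ).baseChange ℚ).b₆ = ((1997 : ℤ) : ℚ) := by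
  rw [c13547_eq]; simp only [WeierstrassCurve.b₂, WeierstrassCurve.b₄, WeierstrassCurve.b₆]; norm_num

/-- **`E[2]` irreducible for `⟨1, 0, 1, -121, 499⟩`**: the monic `u`-cubic `u³ + 1u² − 1928u + 31952` has no root modulo `3`.
[cite: SilvermanAEC2009, III.2.3 (b)] -/
theorem irr_two_n13547 [((⟨1, 0, 1, -121, 499⟩ : WeierstrassCurve ℤ).baseChange ℚ).IsElliptic] : Irr ((⟨1, 0, 1, -121, 499⟩ : WeierstrassCurve ℤ).baseChange ℚ) 2 :=
  irr_two_of_forall_cubic_ne _ c13547_b.1 c13547_b.2.1 c13547_b.2.2 (ℓ := 3) (by decide)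

/-- No rational `2`-torsion abscissa on `⟨1, 0, 1, -121, 499⟩` (the route's `ht` binder). [cite: SilvermanAEC2009, III.2.3 (b)] -/
theorem not_hasRationalTwoTorsionX_n13547 [((⟨1, 0, 1, -121, 499⟩ : WeierstrassCurve ℤ).baseChange ℚ).IsElliptic] : ∀ x : ℚ, ¬ HasRationalTwoTorsionX ((⟨1, 0, 1, -121, 499⟩ : WeierstrassCurve ℤ).baseChange ℚ) x := by
  intro x hx
  exact (O1.irr_two_iff_not_exists_addOrderOf_eq_two _).mp irr_two_n13547 (exists_point_addOrderOf_eq_two hx)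

/-- `Δ_min = −13547`. [cite: SilvermanAEC2009, VII.1] -/
theorem minimalDiscriminantInt_n13547 [((⟨1, 0, 1, -121, 499⟩ : WeierstrassCurve ℤ).baseChange ℚ).IsGloballyMinimal] : ((⟨1, 0, 1, -121, 499⟩ : WeierstrassCurve ℤ).baseChange ℚ).minimalDiscriminantInt = -13547 := by
  rw [Instances.minimalDiscriminantInt_baseChange_int, M13547_Δ]

/-- `Δ_min = −13547 ≡ 5 (mod 8)`: OFF the Kilford stratum (`2 = 𝔭₁𝔭₂` in `ℚ(β)`). [cite: Serre1973, Ch. II §3.3 Thm. 4] -/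
theorem minimalDiscriminantInt_emod_eight_n13547 [((⟨1, 0, 1, -121, 499⟩ : WeierstrassCurve ℤ).baseChange ℚ).IsGloballyMinimal] : ((⟨1, 0, 1, -121, 499⟩ : WeierstrassCurve ℤ).baseChange ℚ).minimalDiscriminantInt % 8 = 5 := by
  rw [minimalDiscriminantInt_n13547]; decide

/-- **`⟨1, 0, 1, -121, 499⟩` is OFF the Kilford stratum.** [cite: Serre1973, Ch. II §3.3 Thm. 4] -/
theorem not_onKilfordStratumAtTwo_n13547 [((⟨1, 0, 1, -121, 499⟩ : WeierstrassCurve ℤ).baseChange ℚ).IsElliptic] [((⟨1, 0, 1, -121, 499⟩ : WeierstrassCurve ℤ).baseChange ℚ).IsGloballyMinimal] : ¬ OnKilfordStratumAtTwo ((⟨1, 0, 1, -121, 499⟩ : WeierstrassCurve ℤ).baseChange ℚ) :=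
  (not_onKilfordStratumAtTwo_iff_minimalDiscriminantInt_emod_eight_ne _ goodOrd_two_n13547).mpr
    (by rw [minimalDiscriminantInt_n13547]; decide)

/-- `Δ < 0` (`ℚ(β)` is a complex cubic field). [cite: SilvermanAEC2009, III.1] -/
theorem Δ_n13547_neg : ((⟨1, 0, 1, -121, 499⟩ : WeierstrassCurve ℤ).baseChange ℚ).Δ < 0 := by
  rw [baseChange_int_Δ, M13547_Δ]; norm_num

/-- **`θ := 3g² + (79/4)g − 947/4 = (−947·4 + 79u + 3u²)/16 ∈ ℚ(β)` is a root of `f = X³ − 8X² + 20X + 7`** (one `linear_combination` against `ψ_W(β) = 4β³ + 1β² + 2·(-241)β + 1997 = 0`;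
the multiplier is the exact quotient in `ℚ[β]`). [cite: LMFDB, number field 3.1.13547.1 (degree 3, discriminant −13547)] [cite: SilvermanAEC2009, III.1] -/
theorem aeval_theta_n13547 {β : AlgebraicClosure ℚ} (hβ : aeval β ((⟨1, 0, 1, -121, 499⟩ : WeierstrassCurve ℤ).baseChange ℚ).twoTorsionPolynomial.toPoly = 0) :
    aeval ((3 : ↥(IntermediateField.adjoin ℚ ({β} : Set (AlgebraicClosure ℚ)))) * (AdjoinSimple.gen ℚ β : ↥(IntermediateField.adjoin ℚ ({β} : Set (AlgebraicClosure ℚ)))) ^ 2 + 79 / 4 * (AdjoinSimple.gen ℚ β : ↥(IntermediateField.adjoin ℚ ({β} : Set (AlgebraicClosure ℚ)))) - 947 / 4) (MonicCubic.poly (-8) (20) (7)) = 0 := by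
  have hψ := psi_gen_eq_zero ((⟨1, 0, 1, -121, 499⟩ : WeierstrassCurve ℤ).baseChange ℚ) hβ
  rw [c13547_b.1, c13547_b.2.1, c13547_b.2.2] at hψ
  set g : ↥(IntermediateField.adjoin ℚ ({β} : Set (AlgebraicClosure ℚ))) := AdjoinSimple.gen ℚ β with hg
  simp only [MonicCubic.poly, map_add, map_mul, map_pow, aeval_X, eq_intCast, map_intCast]
  push_cast at hψ ⊢
  linear_combination ((-439799 / 64 : ↥(IntermediateField.adjoin ℚ ({β} : Set (AlgebraicClosure ℚ)))) * g ^ 0 + (2691 / 64 : ↥(IntermediateField.adjoin ℚ ({β} : Set (AlgebraicClosure ℚ)))) * g ^ 1 + (1053 / 8 : ↥(IntermediateField.adjoin ℚ ({β} : Set (AlgebraicClosure ℚ)))) * g ^ 2 + (27 / 4 : ↥(IntermediateField.adjoin ℚ ({β} : Set (AlgebraicClosure ℚ)))) * g ^ 3) * hψ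

/-- `[ℚ(β) : ℚ] = 3`. [cite: SilvermanAEC2009, III.2.3 (b)] -/
theorem finrank_cubicField_n13547 {β : AlgebraicClosure ℚ} (hβ : aeval β ((⟨1, 0, 1, -121, 499⟩ : WeierstrassCurve ℤ).baseChange ℚ).twoTorsionPolynomial.toPoly = 0) :
    finrank ℚ ↥(IntermediateField.adjoin ℚ ({β} : Set (AlgebraicClosure ℚ))) = 3 := by
  haveI := isElliptic_n13547
  exact AddKatoTwo.finrank_adjoin_root_twoTorsionPolynomial_eq_three _
    (AlignedTransportAtTwoSeed.irr_two_of_forall_not_hasRationalTwoTorsionX _ not_hasRationalTwoTorsionX_n13547) hβ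

/-- **`d_{ℚ(β)} = −13547`**. [cite: LMFDB, number field 3.1.13547.1 (discriminant −13547)] -/
theorem discr_cubicField_n13547 {β : AlgebraicClosure ℚ} (hβ : aeval β ((⟨1, 0, 1, -121, 499⟩ : WeierstrassCurve ℤ).baseChange ℚ).twoTorsionPolynomial.toPoly = 0) :
    (haveI : FiniteDimensional ℚ ↥(IntermediateField.adjoin ℚ ({β} : Set (AlgebraicClosure ℚ))) := IntermediateField.adjoin.finiteDimensional ((AlgebraicClosure.isAlgebraic ℚ).isAlgebraic β).isIntegral;
      haveI : NumberField ↥(IntermediateField.adjoin ℚ ({β} : Set (AlgebraicClosure ℚ))) := NumberField.mk;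
      NumberField.discr ↥(IntermediateField.adjoin ℚ ({β} : Set (AlgebraicClosure ℚ))) = -13547) := by
  haveI : FiniteDimensional ℚ ↥(IntermediateField.adjoin ℚ ({β} : Set (AlgebraicClosure ℚ))) := IntermediateField.adjoin.finiteDimensional ((AlgebraicClosure.isAlgebraic ℚ).isAlgebraic β).isIntegral
  haveI : NumberField ↥(IntermediateField.adjoin ℚ ({β} : Set (AlgebraicClosure ℚ))) := NumberField.mk
  exact CubicDisc13547.discr_eq (finrank_cubicField_n13547 hβ) (aeval_theta_n13547 hβ)

/-- ★ **`h(ℚ(β)) = 1`** (`ℚ(β)` = the cubic field of discriminant `−13547`, this seat's `CubicDisc13547.classNumber_eq_one`). [cite: LMFDB, number field 3.1.13547.1 (class number 1)] -/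
theorem classNumber_cubicField_n13547_eq_one {β : AlgebraicClosure ℚ} (hβ : aeval β ((⟨1, 0, 1, -121, 499⟩ : WeierstrassCurve ℤ).baseChange ℚ).twoTorsionPolynomial.toPoly = 0) :
    (haveI : FiniteDimensional ℚ ↥(IntermediateField.adjoin ℚ ({β} : Set (AlgebraicClosure ℚ))) := IntermediateField.adjoin.finiteDimensional ((AlgebraicClosure.isAlgebraic ℚ).isAlgebraic β).isIntegral;
      haveI : NumberField ↥(IntermediateField.adjoin ℚ ({β} : Set (AlgebraicClosure ℚ))) := NumberField.mk;
      classNumber ↥(IntermediateField.adjoin ℚ ({β} : Set (AlgebraicClosure ℚ))) = 1) := by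
  haveI : FiniteDimensional ℚ ↥(IntermediateField.adjoin ℚ ({β} : Set (AlgebraicClosure ℚ))) := IntermediateField.adjoin.finiteDimensional ((AlgebraicClosure.isAlgebraic ℚ).isAlgebraic β).isIntegral
  haveI : NumberField ↥(IntermediateField.adjoin ℚ ({β} : Set (AlgebraicClosure ℚ))) := NumberField.mk
  exact CubicDisc13547.classNumber_eq_one (finrank_cubicField_n13547 hβ) (aeval_theta_n13547 hβ)

/-- ★ **`2 ∤ h(ℚ(β))`** (the doors' datum verbatim). [cite: LMFDB, number field 3.1.13547.1 (class number 1)] -/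
theorem not_two_dvd_classNumber_cubicField_n13547 {β : AlgebraicClosure ℚ} (hβ : aeval β ((⟨1, 0, 1, -121, 499⟩ : WeierstrassCurve ℤ).baseChange ℚ).twoTorsionPolynomial.toPoly = 0) :
    (haveI : FiniteDimensional ℚ ↥(IntermediateField.adjoin ℚ ({β} : Set (AlgebraicClosure ℚ))) := IntermediateField.adjoin.finiteDimensional ((AlgebraicClosure.isAlgebraic ℚ).isAlgebraic β).isIntegral;
      haveI : NumberField ↥(IntermediateField.adjoin ℚ ({β} : Set (AlgebraicClosure ℚ))) := NumberField.mk;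
      ¬ 2 ∣ classNumber ↥(IntermediateField.adjoin ℚ ({β} : Set (AlgebraicClosure ℚ)))) := by
  haveI : FiniteDimensional ℚ ↥(IntermediateField.adjoin ℚ ({β} : Set (AlgebraicClosure ℚ))) := IntermediateField.adjoin.finiteDimensional ((AlgebraicClosure.isAlgebraic ℚ).isAlgebraic β).isIntegral
  haveI : NumberField ↥(IntermediateField.adjoin ℚ ({β} : Set (AlgebraicClosure ℚ))) := NumberField.mk
  exact CubicDisc13547.not_two_dvd_classNumber (finrank_cubicField_n13547 hβ) (aeval_theta_n13547 hβ)

/-! ## §1 The prime `𝔭₁ = (π₁)` of norm `2` -/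

/-- A ring homomorphism `ψ₂ : 𝓞_{ℚ(β)} → ℤ/2` with `ψ₂(θ) = 1` (the degree-one dyadic prime). [cite: Marcus2018, Ch. 3, Thm. 27] -/
theorem exists_residueHom_two {β : AlgebraicClosure ℚ} (hβ : aeval β ((⟨1, 0, 1, -121, 499⟩ : WeierstrassCurve ℤ).baseChange ℚ).twoTorsionPolynomial.toPoly = 0) :
    ∃ ψ : 𝓞 ↥(IntermediateField.adjoin ℚ ({β} : Set (AlgebraicClosure ℚ))) →+* ZMod 2, ψ (MonicCubic.thetaInt (aeval_theta_n13547 hβ)) = ((-1 : ℤ) : ZMod 2) :=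
  haveI : FiniteDimensional ℚ ↥(IntermediateField.adjoin ℚ ({β} : Set (AlgebraicClosure ℚ))) := IntermediateField.adjoin.finiteDimensional ((AlgebraicClosure.isAlgebraic ℚ).isAlgebraic β).isIntegral
  haveI : NumberField ↥(IntermediateField.adjoin ℚ ({β} : Set (AlgebraicClosure ℚ))) := NumberField.mk
  MonicCubic.exists_ringHom_of_root CubicDisc13547.irreducible_polyQ (aeval_theta_n13547 hβ) (finrank_cubicField_n13547 hβ)
    CubicDisc13547.isUnit_of_disc_eq_sq_mul ((-1 : ℤ) : ZMod 2) (by decide)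

/-- **`N((π₁)) = 2`** for `π₁ = 68 -25θ +3θ²`: `(π₁) = (2, θ − -1)` (this seat's `CubicDisc13547.span_2_lin1_eq`) is the kernel of `ψ₂`, of index `2`.
[cite: Marcus2018, Ch. 3, Thm. 27] [cite: LMFDB, number field 3.1.13547.1] -/
theorem absNorm_span_pi1_n13547 {β : AlgebraicClosure ℚ} (hβ : aeval β ((⟨1, 0, 1, -121, 499⟩ : WeierstrassCurve ℤ).baseChange ℚ).twoTorsionPolynomial.toPoly = 0) :
    haveI : FiniteDimensional ℚ ↥(IntermediateField.adjoin ℚ ({β} : Set (AlgebraicClosure ℚ))) := IntermediateField.adjoin.finiteDimensional ((AlgebraicClosure.isAlgebraic ℚ).isAlgebraic β).isIntegral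
    haveI : NumberField ↥(IntermediateField.adjoin ℚ ({β} : Set (AlgebraicClosure ℚ))) := NumberField.mk
    Ideal.absNorm (Ideal.span {((68 : 𝓞 ↥(IntermediateField.adjoin ℚ ({β} : Set (AlgebraicClosure ℚ)))) + (-25 : 𝓞 ↥(IntermediateField.adjoin ℚ ({β} : Set (AlgebraicClosure ℚ)))) * MonicCubic.thetaInt (aeval_theta_n13547 hβ) + (3 : 𝓞 ↥(IntermediateField.adjoin ℚ ({β} : Set (AlgebraicClosure ℚ)))) * MonicCubic.thetaInt (aeval_theta_n13547 hβ) ^ 2)}) = 2 := by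
  haveI : FiniteDimensional ℚ ↥(IntermediateField.adjoin ℚ ({β} : Set (AlgebraicClosure ℚ))) := IntermediateField.adjoin.finiteDimensional ((AlgebraicClosure.isAlgebraic ℚ).isAlgebraic β).isIntegral
  haveI : NumberField ↥(IntermediateField.adjoin ℚ ({β} : Set (AlgebraicClosure ℚ))) := NumberField.mk
  haveI : Fact (Nat.Prime 2) := ⟨Nat.prime_two⟩
  have hθ := aeval_theta_n13547 hβ
  have h3 := finrank_cubicField_n13547 hβ
  obtain ⟨ψ, hψ⟩ := exists_residueHom_two hβ
  have hexp : ¬ 2 ∣ RingOfIntegers.exponent (MonicCubic.thetaInt hθ) := by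
    rw [MonicCubic.exponent_thetaInt CubicDisc13547.irreducible_polyQ hθ h3 CubicDisc13547.isUnit_of_disc_eq_sq_mul]; decide
  have hker := MonicCubic.ker_residueHom_eq_span CubicDisc13547.irreducible_polyQ hθ hexp ψ hψ
  have hspan : Ideal.span {((2 : ℕ) : 𝓞 ↥(IntermediateField.adjoin ℚ ({β} : Set (AlgebraicClosure ℚ)))), MonicCubic.thetaInt hθ - ((-1 : ℤ) : 𝓞 ↥(IntermediateField.adjoin ℚ ({β} : Set (AlgebraicClosure ℚ))))} = Ideal.span {((68 : 𝓞 ↥(IntermediateField.adjoin ℚ ({β} : Set (AlgebraicClosure ℚ)))) + (-25 : 𝓞 ↥(IntermediateField.adjoin ℚ ({β} : Set (AlgebraicClosure ℚ)))) * MonicCubic.thetaInt hθ + (3 : 𝓞 ↥(IntermediateField.adjoin ℚ ({β} : Set (AlgebraicClosure ℚ)))) * MonicCubic.thetaInt hθ ^ 2)} := by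
    rw [Nat.cast_ofNat, show MonicCubic.thetaInt hθ - ((-1 : ℤ) : 𝓞 ↥(IntermediateField.adjoin ℚ ({β} : Set (AlgebraicClosure ℚ)))) = MonicCubic.thetaInt hθ + 1 by push_cast; ring,
      show ((68 : 𝓞 ↥(IntermediateField.adjoin ℚ ({β} : Set (AlgebraicClosure ℚ)))) + (-25 : 𝓞 ↥(IntermediateField.adjoin ℚ ({β} : Set (AlgebraicClosure ℚ)))) * MonicCubic.thetaInt hθ + (3 : 𝓞 ↥(IntermediateField.adjoin ℚ ({β} : Set (AlgebraicClosure ℚ)))) * MonicCubic.thetaInt hθ ^ 2) = 68 - 25 * MonicCubic.thetaInt hθ + 3 * MonicCubic.thetaInt hθ ^ 2 by ring]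
    exact CubicDisc13547.span_2_lin1_eq hθ
  rw [← hspan, ← hker]
  exact absNorm_ker_zmod ψ

/-! ## §2 ★★★ `e_m = e_1` (`m ≥ 1`), `μ₂ = 0`, `λ₂ = 0` for the cubic field of discriminant `−13547` — UNCONDITIONAL -/

/-- ★★★ **THE LAYER-ONE UNIT DOOR FIRES AT `N = 13547`: for `β ∈ ℚ̄` ANY root of the `2`-division cubic of `⟨1, 0, 1, -121, 499⟩` and EVERY cyclotomic `ℤ₂`-extension `κ` of
`ℚ(β)` (the cubic field of discriminant `−13547`): `e_m(κ) = e_1(κ)` for all `m ≥ 1`, `μ₂(κ) = 0` and `λ₂(κ) = 0`** — NO hypothesis.  att-p3 g41's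
`classicalMuVanishes_adjoin_of_layerOneUnitCert` with every displayed datum decided by the kernel: `h = 1`, `𝔭₁ = (π₁)` of norm `2`, `2 ∉ 𝔭₁²` (`2 ∤ d`), and the
unit `η = A + B√2` of `ℚ(β,√2)` with `AC + 2BD = 1`, `AD + BC = 0`, `A − 1 = π₁²γ₀`, `B = π₁²γ₁`, `γ₀ ≡ 1 (mod π₁)` (`η ≡ 1 (mod P⁴)`, `η` a non-norm from
`ℚ(β, √(2+√2))`, O'Meara 63:10; `N_{K₁/K} η = −ε⁻¹` of class `9 (mod 16)`).  [cite: Fukuda1994, Thm. 1 (1), p. 264] [cite: Lang1990, Ch. 13 §4, Lemma 4.1–4.2 (PDF pp. 203–204)]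
[cite: Omeara1963, §63B (63:10)] [cite: LMFDB, number field 3.1.13547.1 (class number 1)] -/
theorem classNumberPExp_eq_and_mu_lambda_eq_zero_cubicField_n13547 {β : AlgebraicClosure ℚ} (hβ : aeval β ((⟨1, 0, 1, -121, 499⟩ : WeierstrassCurve ℤ).baseChange ℚ).twoTorsionPolynomial.toPoly = 0)
    (κP : ZpExtension ↥(IntermediateField.adjoin ℚ ({β} : Set (AlgebraicClosure ℚ))) 2) (hκP : κP.IsCyclotomic) :
    (∀ m : ℕ, 1 ≤ m → classNumberPExp κP m = classNumberPExp κP 1) ∧ ClassicalMuVanishes κP ∧ classicalLambda κP = 0 := by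
  haveI := isElliptic_n13547
  haveI := isGloballyMinimal_n13547
  haveI : FiniteDimensional ℚ ↥(IntermediateField.adjoin ℚ ({β} : Set (AlgebraicClosure ℚ))) := IntermediateField.adjoin.finiteDimensional ((AlgebraicClosure.isAlgebraic ℚ).isAlgebraic β).isIntegral
  haveI : NumberField ↥(IntermediateField.adjoin ℚ ({β} : Set (AlgebraicClosure ℚ))) := NumberField.mk
  have hord : IsOrdinaryAt ((⟨1, 0, 1, -121, 499⟩ : WeierstrassCurve ℤ).baseChange ℚ) 2 := goodOrd_two_n13547
  have ht := not_hasRationalTwoTorsionX_n13547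
  have hs := not_onKilfordStratumAtTwo_n13547
  have hθ := aeval_theta_n13547 hβ
  have h3 := finrank_cubicField_n13547 hβ
  have hN := absNorm_span_pi1_n13547 hβ
  set θI : 𝓞 ↥(IntermediateField.adjoin ℚ ({β} : Set (AlgebraicClosure ℚ))) := MonicCubic.thetaInt hθ with hθI
  have hrel : θI ^ 3 + (-8 : 𝓞 ↥(IntermediateField.adjoin ℚ ({β} : Set (AlgebraicClosure ℚ)))) * θI ^ 2 + (20 : 𝓞 ↥(IntermediateField.adjoin ℚ ({β} : Set (AlgebraicClosure ℚ)))) * θI + (7 : 𝓞 ↥(IntermediateField.adjoin ℚ ({β} : Set (AlgebraicClosure ℚ)))) = 0 := by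
    have h := MonicCubic.thetaInt_rel hθ
    push_cast at h
    linear_combination h
  -- `(π₁)` is a prime containing `2` (so `2 ∉ (π₁)²` from `2 ∤ d`), `π₁ ∉ (π₁)²`, `1 ∉ (π₁)`
  have h2mem : (2 : 𝓞 ↥(IntermediateField.adjoin ℚ ({β} : Set (AlgebraicClosure ℚ)))) ∈ Ideal.span {((68 : 𝓞 ↥(IntermediateField.adjoin ℚ ({β} : Set (AlgebraicClosure ℚ)))) + (-25 : 𝓞 ↥(IntermediateField.adjoin ℚ ({β} : Set (AlgebraicClosure ℚ)))) * θI + (3 : 𝓞 ↥(IntermediateField.adjoin ℚ ({β} : Set (AlgebraicClosure ℚ)))) * θI ^ 2)} :=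
    Ideal.mem_span_singleton'.mpr ⟨((-1 : 𝓞 ↥(IntermediateField.adjoin ℚ ({β} : Set (AlgebraicClosure ℚ)))) + (-3 : 𝓞 ↥(IntermediateField.adjoin ℚ ({β} : Set (AlgebraicClosure ℚ)))) * θI + (1 : 𝓞 ↥(IntermediateField.adjoin ℚ ({β} : Set (AlgebraicClosure ℚ)))) * θI ^ 2), by linear_combination ((-10 : 𝓞 ↥(IntermediateField.adjoin ℚ ({β} : Set (AlgebraicClosure ℚ)))) * θI ^ 0 + (3 : 𝓞 ↥(IntermediateField.adjoin ℚ ({β} : Set (AlgebraicClosure ℚ)))) * θI ^ 1) * hrel⟩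
  haveI hprime : (Ideal.span {((68 : 𝓞 ↥(IntermediateField.adjoin ℚ ({β} : Set (AlgebraicClosure ℚ)))) + (-25 : 𝓞 ↥(IntermediateField.adjoin ℚ ({β} : Set (AlgebraicClosure ℚ)))) * θI + (3 : 𝓞 ↥(IntermediateField.adjoin ℚ ({β} : Set (AlgebraicClosure ℚ)))) * θI ^ 2)}).IsPrime :=
    Ideal.isPrime_of_irreducible_absNorm (by rw [hN]; exact Nat.prime_two)
  have hd : ¬ (2 : ℤ) ∣ NumberField.discr ↥(IntermediateField.adjoin ℚ ({β} : Set (AlgebraicClosure ℚ))) := by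
    rw [CubicDisc13547.discr_eq h3 hθ]; norm_num
  have hunr : (2 : 𝓞 ↥(IntermediateField.adjoin ℚ ({β} : Set (AlgebraicClosure ℚ)))) ∉ Ideal.span {((68 : 𝓞 ↥(IntermediateField.adjoin ℚ ({β} : Set (AlgebraicClosure ℚ)))) + (-25 : 𝓞 ↥(IntermediateField.adjoin ℚ ({β} : Set (AlgebraicClosure ℚ)))) * θI + (3 : 𝓞 ↥(IntermediateField.adjoin ℚ ({β} : Set (AlgebraicClosure ℚ)))) * θI ^ 2)} ^ 2 := two_not_mem_sq_of_not_dvd_discr hd _ h2mem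
  have htop : Ideal.span {((68 : 𝓞 ↥(IntermediateField.adjoin ℚ ({β} : Set (AlgebraicClosure ℚ)))) + (-25 : 𝓞 ↥(IntermediateField.adjoin ℚ ({β} : Set (AlgebraicClosure ℚ)))) * θI + (3 : 𝓞 ↥(IntermediateField.adjoin ℚ ({β} : Set (AlgebraicClosure ℚ)))) * θI ^ 2)} ≠ ⊤ := hprime.ne_top
  have hone : ∀ {x y : 𝓞 ↥(IntermediateField.adjoin ℚ ({β} : Set (AlgebraicClosure ℚ)))}, x - 1 = ((68 : 𝓞 ↥(IntermediateField.adjoin ℚ ({β} : Set (AlgebraicClosure ℚ)))) + (-25 : 𝓞 ↥(IntermediateField.adjoin ℚ ({β} : Set (AlgebraicClosure ℚ)))) * θI + (3 : 𝓞 ↥(IntermediateField.adjoin ℚ ({β} : Set (AlgebraicClosure ℚ)))) * θI ^ 2) * y → x ∉ Ideal.span {((68 : 𝓞 ↥(IntermediateField.adjoin ℚ ({β} : Set (AlgebraicClosure ℚ)))) + (-25 : 𝓞 ↥(IntermediateField.adjoin ℚ ({β} : Set (AlgebraicClosure ℚ)))) * θI + (3 : 𝓞 ↥(IntermediateField.adjoin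 ℚ ({β} : Set (AlgebraicClosure ℚ)))) * θI ^ 2)} := fun {x y} h hx => htop
    (Ideal.eq_top_of_isUnit_mem _ (x := 1) (by
      have hm : x - ((68 : 𝓞 ↥(IntermediateField.adjoin ℚ ({β} : Set (AlgebraicClosure ℚ)))) + (-25 : 𝓞 ↥(IntermediateField.adjoin ℚ ({β} : Set (AlgebraicClosure ℚ)))) * θI + (3 : 𝓞 ↥(IntermediateField.adjoin ℚ ({β} : Set (AlgebraicClosure ℚ)))) * θI ^ 2) * y ∈ Ideal.span {((68 : 𝓞 ↥(IntermediateField.adjoin ℚ ({β} : Set (AlgebraicClosure ℚ)))) + (-25 : 𝓞 ↥(IntermediateField.adjoin ℚ ({β} : Set (AlgebraicClosure ℚ)))) * θI + (3 : 𝓞 ↥(IntermediateField.adjoin ℚ ({β} : Set (AlgebraicClosure ℚ)))) * θI ^ 2)} :=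
        Ideal.sub_mem _ hx (Ideal.mul_mem_right _ _ (Ideal.mem_span_singleton_self _))
      rwa [show x - ((68 : 𝓞 ↥(IntermediateField.adjoin ℚ ({β} : Set (AlgebraicClosure ℚ)))) + (-25 : 𝓞 ↥(IntermediateField.adjoin ℚ ({β} : Set (AlgebraicClosure ℚ)))) * θI + (3 : 𝓞 ↥(IntermediateField.adjoin ℚ ({β} : Set (AlgebraicClosure ℚ)))) * θI ^ 2) * y = 1 by linear_combination h] at hm) isUnit_one)
  have hπsq : ((68 : 𝓞 ↥(IntermediateField.adjoin ℚ ({β} : Set (AlgebraicClosure ℚ)))) + (-25 : 𝓞 ↥(IntermediateField.adjoin ℚ ({β} : Set (AlgebraicClosure ℚ)))) * θI + (3 : 𝓞 ↥(IntermediateField.adjoin ℚ ({β} : Set (AlgebraicClosure ℚ)))) * θI ^ 2) ∉ Ideal.span {((68 : 𝓞 ↥(IntermediateField.adjoin ℚ ({β} : Set (AlgebraicClosure ℚ)))) + (-25 : 𝓞 ↥(IntermediateField.adjoin ℚ ({β} : Set (AlgebraicClosure ℚ)))) * θI + (3 : 𝓞 ↥(IntermediateField.adjoin ℚ ({β} :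 Set (AlgebraicClosure ℚ)))) * θI ^ 2)} ^ 2 := by
    rw [Ideal.span_singleton_pow, Ideal.mem_span_singleton']
    rintro ⟨x, hx⟩
    have h2 : (2 : 𝓞 ↥(IntermediateField.adjoin ℚ ({β} : Set (AlgebraicClosure ℚ)))) = ((68 : 𝓞 ↥(IntermediateField.adjoin ℚ ({β} : Set (AlgebraicClosure ℚ)))) + (-25 : 𝓞 ↥(IntermediateField.adjoin ℚ ({β} : Set (AlgebraicClosure ℚ)))) * θI + (3 : 𝓞 ↥(IntermediateField.adjoin ℚ ({β} : Set (AlgebraicClosure ℚ)))) * θI ^ 2) * ((-1 : 𝓞 ↥(IntermediateField.adjoin ℚ ({β} : Set (AlgebraicClosure ℚ)))) + (-3 : 𝓞 ↥(IntermediateField.adjoin ℚ ({β} : Set (AlgebraicClosure ℚ)))) * θI + (1 : 𝓞 ↥(IntermediateField.adjoin ℚ ({β} : Set (AlgebraicClosure ℚ)))) * θI ^ 2) := by linear_combination ((10 : 𝓞 ↥(IntermediateField.adjoin ℚ ({β} : Set (AlgebraicClosure ℚ)))) * θI ^ 0 + (-3 : 𝓞 ↥(IntermediateField.adjoin ℚ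 ({β} : Set (AlgebraicClosure ℚ)))) * θI ^ 1) * hrel
    have hx2 : (2 : 𝓞 ↥(IntermediateField.adjoin ℚ ({β} : Set (AlgebraicClosure ℚ)))) * (x * ((68 : 𝓞 ↥(IntermediateField.adjoin ℚ ({β} : Set (AlgebraicClosure ℚ)))) + (-25 : 𝓞 ↥(IntermediateField.adjoin ℚ ({β} : Set (AlgebraicClosure ℚ)))) * θI + (3 : 𝓞 ↥(IntermediateField.adjoin ℚ ({β} : Set (AlgebraicClosure ℚ)))) * θI ^ 2) - 1) = 0 := by linear_combination (((-1 : 𝓞 ↥(IntermediateField.adjoin ℚ ({β} : Set (AlgebraicClosure ℚ)))) + (-3 : 𝓞 ↥(IntermediateField.adjoin ℚ ({β} : Set (AlgebraicClosure ℚ)))) * θI + (1 : 𝓞 ↥(IntermediateField.adjoin ℚ ({β} : Set (AlgebraicClosure ℚ)))) * θI ^ 2)) * hx + (x * ((68 : 𝓞 ↥(IntermediateField.adjoin ℚ ({β} : Set (AlgebraicClosure ℚ)))) + (-25 : 𝓞 ↥(IntermediateField.adjoin ℚ ({β} : Set (AlgebraicClosure ℚ)))) * θI + (3 : 𝓞 ↥(IntermediateField.adjoin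 ℚ ({β} : Set (AlgebraicClosure ℚ)))) * θI ^ 2) - 1) * h2
    rcases mul_eq_zero.mp hx2 with h0 | h0
    · exact absurd h0 two_ne_zero
    · exact htop (Ideal.eq_top_of_isUnit_mem _ (Ideal.mem_span_singleton_self _) (IsUnit.of_mul_eq_one x (by linear_combination h0)))
  exact classicalMuVanishes_adjoin_of_layerOneUnitCert ((⟨1, 0, 1, -121, 499⟩ : WeierstrassCurve ℤ).baseChange ℚ) hord ht hs hβ (not_two_dvd_classNumber_cubicField_n13547 hβ) (Ideal.span {((68 : 𝓞 ↥(IntermediateField.adjoin ℚ ({β} : Set (AlgebraicClosure ℚ)))) + (-25 : 𝓞 ↥(IntermediateField.adjoin ℚ ({β} : Set (AlgebraicClosure ℚ)))) * θI + (3 : 𝓞 ↥(IntermediateField.adjoin ℚ ({β} : Set (AlgebraicClosure ℚ)))) * θI ^ 2)}) hN hunr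
    (A := ((14 : 𝓞 ↥(IntermediateField.adjoin ℚ ({β} : Set (AlgebraicClosure ℚ)))) + (43 : 𝓞 ↥(IntermediateField.adjoin ℚ ({β} : Set (AlgebraicClosure ℚ)))) * θI + (0 : 𝓞 ↥(IntermediateField.adjoin ℚ ({β} : Set (AlgebraicClosure ℚ)))) * θI ^ 2)) (B := ((11 : 𝓞 ↥(IntermediateField.adjoin ℚ ({β} : Set (AlgebraicClosure ℚ)))) + (37 : 𝓞 ↥(IntermediateField.adjoin ℚ ({β} : Set (AlgebraicClosure ℚ)))) * θI + (0 : 𝓞 ↥(IntermediateField.adjoin ℚ ({β} : Set (AlgebraicClosure ℚ)))) * θI ^ 2)) (C := ((-285779578 : 𝓞 ↥(IntermediateField.adjoin ℚ ({β} : Set (AlgebraicClosure ℚ)))) + (105190606 : 𝓞 ↥(IntermediateField.adjoin ℚ ({β} : Set (AlgebraicClosure ℚ)))) * θI + (-12658231 : 𝓞 ↥(IntermediateField.adjoin ℚ ({β} : Set (AlgebraicClosure ℚ)))) * θI ^ 2)) (D := ((-202076678 : 𝓞 ↥(IntermediateField.adjoin ℚ ({β} : Set (AlgebraicClosure ℚ))))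 + (74380991 : 𝓞 ↥(IntermediateField.adjoin ℚ ({β} : Set (AlgebraicClosure ℚ)))) * θI + (-8950721 : 𝓞 ↥(IntermediateField.adjoin ℚ ({β} : Set (AlgebraicClosure ℚ)))) * θI ^ 2)) (π₁ := ((68 : 𝓞 ↥(IntermediateField.adjoin ℚ ({β} : Set (AlgebraicClosure ℚ)))) + (-25 : 𝓞 ↥(IntermediateField.adjoin ℚ ({β} : Set (AlgebraicClosure ℚ)))) * θI + (3 : 𝓞 ↥(IntermediateField.adjoin ℚ ({β} : Set (AlgebraicClosure ℚ)))) * θI ^ 2)) (d := 1) (γ₀ := ((-268 : 𝓞 ↥(IntermediateField.adjoin ℚ ({β} : Set (AlgebraicClosure ℚ)))) + (-918 : 𝓞 ↥(IntermediateField.adjoin ℚ ({β} : Set (AlgebraicClosure ℚ)))) * θI + (-173 : 𝓞 ↥(IntermediateField.adjoin ℚ ({β} : Set (AlgebraicClosure ℚ)))) * θI ^ 2)) (γ₁ := ((-230 : 𝓞 ↥(IntermediateField.adjoin ℚ ({β} : Set (AlgebraicClosure ℚ)))) + (-788 : 𝓞 ↥(IntermediateField.adjoin ℚ ({β} : Set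 (AlgebraicClosure ℚ)))) * θI + (-149 : 𝓞 ↥(IntermediateField.adjoin ℚ ({β} : Set (AlgebraicClosure ℚ)))) * θI ^ 2))
    (by linear_combination ((-1206657287 : 𝓞 ↥(IntermediateField.adjoin ℚ ({β} : Set (AlgebraicClosure ℚ)))) * θI ^ 0) * hrel) (by linear_combination ((-853235550 : 𝓞 ↥(IntermediateField.adjoin ℚ ({β} : Set (AlgebraicClosure ℚ)))) * θI ^ 0) * hrel)
    (Ideal.mem_span_singleton_self _) hπsq (hone (y := 0) (by ring)) (hone (y := ((6375 : 𝓞 ↥(IntermediateField.adjoin ℚ ({β} : Set (AlgebraicClosure ℚ)))) + (19298 : 𝓞 ↥(IntermediateField.adjoin ℚ ({β} : Set (AlgebraicClosure ℚ)))) * θI + (-4073 : 𝓞 ↥(IntermediateField.adjoin ℚ ({β} : Set (AlgebraicClosure ℚ)))) * θI ^ 2)) (by linear_combination ((-61967 : 𝓞 ↥(IntermediateField.adjoin ℚ ({β} : Set (AlgebraicClosure ℚ)))) * θI ^ 0 + (12219 : 𝓞 ↥(IntermediateField.adjoin ℚ ({β} : Set (AlgebraicClosure ℚ)))) * θI ^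 1) * hrel))
    (by linear_combination ((177035 : 𝓞 ↥(IntermediateField.adjoin ℚ ({β} : Set (AlgebraicClosure ℚ)))) * θI ^ 0 + (-29575 : 𝓞 ↥(IntermediateField.adjoin ℚ ({β} : Set (AlgebraicClosure ℚ)))) * θI ^ 1 + (-5232 : 𝓞 ↥(IntermediateField.adjoin ℚ ({β} : Set (AlgebraicClosure ℚ)))) * θI ^ 2 + (1557 : 𝓞 ↥(IntermediateField.adjoin ℚ ({β} : Set (AlgebraicClosure ℚ)))) * θI ^ 3) * hrel) (by linear_combination ((151933 : 𝓞 ↥(IntermediateField.adjoin ℚ ({β} : Set (AlgebraicClosure ℚ)))) * θI ^ 0 + (-25273 : 𝓞 ↥(IntermediateField.adjoin ℚ ({β} : Set (AlgebraicClosure ℚ)))) * θI ^ 1 + (-4530 : 𝓞 ↥(IntermediateField.adjoin ℚ ({β} : Set (AlgebraicClosure ℚ)))) * θI ^ 2 + (1341 : 𝓞 ↥(IntermediateField.adjoin ℚ ({β} : Set (AlgebraicClosure ℚ)))) * θI ^ 3) * hrel) κP hκP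

/-- ★★ **`μ₂ = 0` for EVERY cyclotomic `ℤ₂`-extension of the cubic field `ℚ(β)` of discriminant `−13547`** (carrier-road form). [cite: Fukuda1994, Thm. 1 (1), p. 264] -/
theorem classicalMuVanishes_cubicField_n13547 {β : AlgebraicClosure ℚ} (hβ : aeval β ((⟨1, 0, 1, -121, 499⟩ : WeierstrassCurve ℤ).baseChange ℚ).twoTorsionPolynomial.toPoly = 0)
    (κP : ZpExtension ↥(IntermediateField.adjoin ℚ ({β} : Set (AlgebraicClosure ℚ))) 2) (hκP : κP.IsCyclotomic) : ClassicalMuVanishes κP :=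
  (classNumberPExp_eq_and_mu_lambda_eq_zero_cubicField_n13547 hβ κP hκP).2.1

/-! ## §3 The kernel row: `MC₂(W)` for `W = ⟨1, 0, 1, -121, 499⟩` modulo PRINT⁵ + MuIneqʳ (C2 at this seed) -/

/-- The `2`-division cubic of `⟨1, 0, 1, -121, 499⟩` has a root in `ℚ̄`. [cite: SilvermanAEC2009, III.1] -/
theorem exists_root_twoTorsionPolynomial_n13547 : ∃ β : AlgebraicClosure ℚ, aeval β ((⟨1, 0, 1, -121, 499⟩ : WeierstrassCurve ℤ).baseChange ℚ).twoTorsionPolynomial.toPoly = 0 := by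
  apply IsAlgClosed.exists_aeval_eq_zero
  rw [Cubic.degree_of_a_ne_zero (by simp [WeierstrassCurve.twoTorsionPolynomial])]
  decide

/-- ★ **THE ROW — `C2` AT THE SEED `⟨1, 0, 1, -121, 499⟩` (`N = 13547`): `MazurMainConjecture W 2`** from PRINT⁵ {`h17`, `hGr`, `hper`, `hmod`, `hGZK`} + `hI` = MuIneqʳ
(registered stub of line `birth`, VERBATIM) + the crux's own hypotheses at this `W` (`r_an = 0`, analytic `μ₂ = 0`, `BSD₂(W)`); every other binder of
att-p5 g24's carrier road is a theorem of this file (`μ₂ = 0` from the layer-one unit door).  CONDITIONAL on the named facts and the stub; BSD is NOT proved;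
nothing is closed. [cite: Kato2004Asterisque, Thm. 17.4 (1)(2) (p. 273)] [cite: GreenbergLNM1716, Thm. 4.1 (p. 102) and Conj. 1.11 (p. 58)]
[cite: Iwasawa1973MuInvariants, Thm. 2 and Thm. 3] [cite: Fukuda1994, Thm. 1 (1), p. 264] -/
theorem mazurMainConjecture_two_n13547 [((⟨1, 0, 1, -121, 499⟩ : WeierstrassCurve ℤ).baseChange ℚ).IsElliptic] [((⟨1, 0, 1, -121, 499⟩ : WeierstrassCurve ℤ).baseChange ℚ).IsGloballyMinimal]
    (h17 : ∀ [NeZero (((⟨1, 0, 1, -121, 499⟩ : WeierstrassCurve ℤ).baseChange ℚ).conductorNorm ℤ)] (f : CuspForm (Gamma0 (((⟨1, 0, 1, -121, 499⟩ : WeierstrassCurve ℤ).baseChange ℚ).conductorNorm ℤ)) 2),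
      kato_divisibility_allPrimes ((⟨1, 0, 1, -121, 499⟩ : WeierstrassCurve ℤ).baseChange ℚ) 2 (f := f))
    (hGr : Greenberg1999.thm41_charValue_rankZero_anyPrime)
    (hper : realPeriodRat_eq_unit_mul_plusPeriod_two) (hmod : nonempty_modularParametrizationData)
    (hGZK : rank_eq_analyticRank_of_analyticRank_le_one)
    (hI : ∀ (W : WeierstrassCurve ℚ) [W.IsElliptic] [W.IsGloballyMinimal], IsOrdinaryAt W 2 →
      (∀ x : ℚ, ¬ HasRationalTwoTorsionX W x) →
      ∀ (κ : ZpExtension ℚ 2) (γ : Field.absoluteGaloisGroup ℚ), κ.IsCyclotomic →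
      κ.IsTopGenerator γ → IsCyclotomicVariable 2 γ →
      ∀ ⦃N : ℕ⦄ [NeZero N] (f : CuspForm (Gamma0 N) 2), IsNewformOf W f →
      ∀ Gp : IwasawaAlgebra 2, iwasawaToPowerSeries 2 Gp = padicLFunction f (unitRoot W 2 : ℚ_[2]) →
      ∀ (D : W.SelmerDualData κ γ) (Yr : W.FineSelmerDualDataRelaxedInf κ γ),
        lengthAt (IwasawaAlgebra 2) D.X ⟨IwasawaAlgebra.augIdealP 2, IwasawaAlgebra.isPrime_augIdealP_holds 2⟩ ≤
          lengthAt (IwasawaAlgebra 2) (IwasawaAlgebra 2 ⧸ Ideal.span {Gp})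
              ⟨IwasawaAlgebra.augIdealP 2, IwasawaAlgebra.isPrime_augIdealP_holds 2⟩ +
            lengthAt (IwasawaAlgebra 2) Yr.X ⟨IwasawaAlgebra.augIdealP 2, IwasawaAlgebra.isPrime_augIdealP_holds 2⟩)
    (hr : ((⟨1, 0, 1, -121, 499⟩ : WeierstrassCurve ℤ).baseChange ℚ).analyticRank = 0)
    (hμan : ∀ ⦃N : ℕ⦄ [NeZero N] (f : CuspForm (Gamma0 N) 2), IsNewformOf ((⟨1, 0, 1, -121, 499⟩ : WeierstrassCurve ℤ).baseChange ℚ) f →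
      ∀ G : IwasawaAlgebra 2, IsEvenBranchLiftAtTwo ((⟨1, 0, 1, -121, 499⟩ : WeierstrassCurve ℤ).baseChange ℚ) f G → red G ≠ 0)
    (hbsd : BSDp ((⟨1, 0, 1, -121, 499⟩ : WeierstrassCurve ℤ).baseChange ℚ) 2) :
    MazurMainConjecture ((⟨1, 0, 1, -121, 499⟩ : WeierstrassCurve ℤ).baseChange ℚ) 2 := by
  obtain ⟨β, hβ⟩ := exists_root_twoTorsionPolynomial_n13547
  exact mazurMainConjecture_two_of_muIneqRel_of_classicalMu_cubicField_of_Δ_neg ((⟨1, 0, 1, -121, 499⟩ : WeierstrassCurve ℤ).baseChange ℚ) h17 hGr hper hmod hGZK hI goodOrd_two_n13547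
    not_hasRationalTwoTorsionX_n13547 Δ_n13547_neg hr hμan hbsd hβ (fun κP hκP => classicalMuVanishes_cubicField_n13547 hβ κP hκP)

end Summit.BirchSwinnertonDyer.BirchSwinnertonDyer.Theorems.AlignedTransportAtTwoCubicLayerOneRowN13547

end
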